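import Summits.AtomisticToContinuum.HydrodynamicLimit.Theorems.MourreKoopmanChargesLinearToEntropyInBandWindowClauseExponent
import Literature.MathematicalPhysics.KineticTheory.HardSphereEulerPrimitiveForm
import HarnessLib

/-!
# Route `MourreKoopmanCharges`, crux `LinearToEntropyInBand` (stmt-AtomisticToContinuum-17740), skeleton v8:
# stub 4a-ii, the Euler structure of the entropy variables, part B (the 1-homogeneity defect = the `Cst` slot)

Support file (`--supports stmt-AtomisticToContinuum-17740`; registered helper `stub_windowClauseEulerDefect`; worker of lead
prover-line-…-17740-c5-0, wave 5; plan `work/stubs/WINDOWCLAUSE-PLAN.md` § 1 D).  Companion of part A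
(`…WindowClauseEulerStructure`: `∂ₜλ = −DF(U)ᵀ∇λ` coefficient-wise), independent of it.

* `eulerFluxPairing_sub_linearised_self` — ONLY THE EXCESS PART `Z(ρσ³)` OF THE EQUATION OF STATE BREAKS THE
  1-HOMOGENEITY OF THE hs-EULER FLUX: at an Euler state `U = (ρ, ρu, E)`, `E = ρ(‖u‖²/2 + 3θ/2)`, `p = ρθZ(ρσ³)`, tested
  against the entropy-variable gradients `A_j = ∇(u_j/θ)`, `A₄ = ∇(−θ⁻¹)` (any `A₀`), the flux minus its linearisation
  (the `let`s of part A, same letters) applied to `U` itself is `∇λ : [F(U) − DF(U)U] = −ρ (ρσ³) Z′(ρσ³) div u`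
  POINTWISE (`p − Dp·U = −ρθ(ρσ³)Z′`, `Σ_j ∂_j(u_j/θ) + u·∇θ/θ² = div u/θ`) — verbatim the integrand of the `Cst(s)` slot
  `∫ ρ_s (ρ_s σ³) Z′(ρ_s σ³) div u_s dx` of `HydroLimitInBandHeart.WindowClauseInBand` (sign: the block remainder carries
  `−w(N+1) Cst(s)`, plan § 1 D).  Pure one-slice torus calculus; no Euler equation, no EOS window.
* `visFluxIntegrand_eulerState` — the integrand of `visFluxDensityN` (DefsB (e) / toolkit A) read at an exact Euler
  block state `(ρ̄, m̄, ē) = (ρ₀, ρ₀u₀, E)` with the EOS cap inactive (`0 < ρ₀ ≤ 2ρs₀`) IS this tested flux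
  (`w̄ = u₀`, `(2/3)(ē/ρ̄ − ‖w̄‖²/2) = θ₀`, `p = hsPressure σ ρ₀ θ₀`), so that per time `r` of the window
  `visFluxN(∇λ_s)(y) + Σᵢ ∂ₜλ_s(xᵢ)·η(vᵢ) = (N+1)∫ {∇λ_s : [F̂(Ū_vis) − F(U_s) − DF(U_s)(Ū_vis − U_s)] − ρ_s(ρ_sσ³)Z′ div u_s
  − ∇λ_s : DF(U_s)(Ū_all − Ū_vis)} dx +` (cone-smoothing commutator): the `Quad / Cst / InvContent / Smooth` split.

Nothing here restates the crux, a stub, a neighbour's stub or the Statement.  References: H.-T. Yau, Lett. Math. Phys. 22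
(1991) § 2; H. Spohn, *Large Scale Dynamics of Interacting Particles* (1991), Part I § 3.3; S. Olla, S. R. S. Varadhan,
H.-T. Yau, Commun. Math. Phys. 155 (1993) § 3.
-/

noncomputable section

open MeasureTheory Filter Set
open scoped ENNReal Topology InnerProductSpace BigOperators

namespace Summit.AtomisticToContinuum.HydrodynamicLimit.Theorems.LTEInBand

open Literature.MathematicalPhysics.KineticTheory Literature.Analysis.FluidPDE Literature.Analysis.FunctionSpaces
open Literature.MathematicalPhysics.KineticTheory.HsEulerCalc

/-! ## The 1-homogeneity defect of the tested hs-Euler flux (the `Cst` slot) -/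

section Defect

/-- **Only the excess part `Z(ρσ³)` of the equation of state breaks the 1-homogeneity of the hs-Euler flux**:
at an Euler state `U = (ρ, ρu, E)`, `E = ρ(‖u‖²/2 + 3θ/2)`, `p = ρθZ(ρσ³)`, tested against the entropy-variable
gradients `A_j = ∇(u_j/θ)`, `A₄ = ∇(−θ⁻¹)` (any `A₀`), the flux minus its linearisation applied to `U` itself is
`∇λ : [F(U) − DF(U) U] = −ρ (ρσ³) Z′(ρσ³) div u` pointwise (`p − Dp·U = −ρθ (ρσ³) Z′`,
`Σ_j ∂_j(u_j/θ) + u·∇θ/θ² = div u/θ`) — the integrand of the `Cst(s)` slot of `WindowClauseInBand`. -/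
theorem eulerFluxPairing_sub_linearised_self {θ : T3 → ℝ} {u : T3 → V3} (hθ : Torus.IsSmooth θ)
    (hu : Torus.IsSmooth u) (hθ0 : ∀ x, 0 < θ x) (σ ρ₀ : ℝ) (A₀ : V3) (x : T3) :
    (let u₀ : V3 := u x
     let θ₀ : ℝ := θ x
     let Z : ℝ := hsCompressibility (ρ₀ * σ ^ 3)
     let Z' : ℝ := deriv hsCompressibility (ρ₀ * σ ^ 3)
     let p : ℝ := hsPressure σ ρ₀ θ₀
     let E : ℝ := totalEnergyDensity ρ₀ u₀ θ₀
     let A : Fin 3 → V3 := fun j => Torus.gradient (fun y => u y j / θ y) x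
     let A₄ : V3 := Torus.gradient (fun y => -(θ y)⁻¹) x
     let F0 : Fin 3 → ℝ := fun k => ρ₀ * u₀ k
     let Fm : Fin 3 → Fin 3 → ℝ := fun k j => ρ₀ * u₀ k * u₀ j + (if k = j then p else 0)
     let Fe : Fin 3 → ℝ := fun k => (E + p) * u₀ k
     let δρ : ℝ := ρ₀
     let δm : V3 := ρ₀ • u₀
     let δE : ℝ := E
     let δu : Fin 3 → ℝ := fun k => (δm k - u₀ k * δρ) / ρ₀
     let δp : ℝ := 2 / 3 * Z * (δE - (∑ j, u₀ j * δm j) + ‖u₀‖ ^ 2 / 2 * δρ) + θ₀ * (ρ₀ * σ ^ 3) * Z' * δρ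
     let δF0 : Fin 3 → ℝ := fun k => δm k
     let δFm : Fin 3 → Fin 3 → ℝ := fun k j =>
       u₀ j * δm k + u₀ k * δm j - u₀ k * u₀ j * δρ + (if k = j then δp else 0)
     let δFe : Fin 3 → ℝ := fun k => (E + p) * δu k + u₀ k * (δE + δp)
     (∑ k, (A₀ k * F0 k + (∑ j, A j k * Fm k j) + A₄ k * Fe k)) -
         ∑ k, (A₀ k * δF0 k + (∑ j, A j k * δFm k j) + A₄ k * δFe k) =
       -(ρ₀ * (ρ₀ * σ ^ 3) * Z' * Torus.divergence u x)) := by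
  dsimp only
  have hθx : θ x ≠ 0 := (hθ0 x).ne'
  have hθ1 : Torus.IsContDiff 1 θ := hθ.isContDiff (by simp)
  have hu1 : Torus.IsContDiff 1 u := hu.isContDiff (by simp)
  have huj1 : ∀ j, Torus.IsContDiff 1 (fun y => u y j) := fun j => isContDiff_apply_coord hu1 j
  have cθ := fun k => hasDerivAt_coordLine hθ1 x k
  have cu := fun k j => hasDerivAt_coordLine (huj1 j) x k
  have hLj1 : ∀ j, Torus.IsContDiff 1 (fun y => u y j / θ y) := fun j =>
    (isSmooth_vel_div hθ hu hθ0 j).isContDiff (by simp)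
  have hL41 : Torus.IsContDiff 1 (fun y => -(θ y)⁻¹) := (isSmooth_neg_inv hθ hθ0).isContDiff (by simp)
  have hXj : ∀ k j, Torus.partialDeriv k (fun y => u y j / θ y) x =
      Torus.partialDeriv k (fun y => u y j) x / θ x - u x j * Torus.partialDeriv k θ x / θ x ^ 2 := by
    intro k j
    refine partialDeriv_eq_of_hasDerivAt (((cu k j).fun_div (cθ k) (hθ0 _).ne').congr_deriv ?_)
    simp only [zero_smul, Torus.proj_zero, add_zero]
    field_simp
  have hX4 : ∀ k, Torus.partialDeriv k (fun y => -(θ y)⁻¹) x = Torus.partialDeriv k θ x / θ x ^ 2 := by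
    intro k
    refine partialDeriv_eq_of_hasDerivAt ((((cθ k).fun_inv (hθ0 _).ne').fun_neg).congr_deriv ?_)
    simp only [zero_smul, Torus.proj_zero, add_zero]
    field_simp
  have hnorm : ‖u x‖ ^ 2 = (u x 0) ^ 2 + (u x 1) ^ 2 + (u x 2) ^ 2 := by
    simp only [EuclideanSpace.norm_sq_eq, Fin.sum_univ_three, Real.norm_eq_abs, sq_abs]
  simp only [gradient_apply_eq_partialDeriv (hLj1 _), gradient_apply_eq_partialDeriv hL41, hXj, hX4,
    Torus.divergence, totalEnergyDensity, hsPressure, hnorm, PiLp.smul_apply, smul_eq_mul, Fin.sum_univ_three,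
    Fin.isValue, Fin.reduceEq, if_true, if_false]
  field_simp
  ring

/-- **The tested flux of `visCoreN` at an exact Euler block state.** The integrand of `visFluxDensityN` (DefsB (e) /
toolkit A), read at block values `(ρ̄, m̄, ē) = (ρ₀, ρ₀u₀, E)`, `E = ρ₀(‖u₀‖²/2 + 3θ₀/2)`, `0 < ρ₀ ≤ 2ρs₀` (EOS cap
inactive), is the hs-Euler flux `F(U) = (ρu, ρu⊗u + pI, (E + p)u)`, `p = hsPressure σ ρ₀ θ₀`, tested against
`(A₀, A, A₄)`: `w̄ = u₀`, `(2/3)(ē/ρ̄ − ‖w̄‖²/2) = θ₀`. -/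
theorem visFluxIntegrand_eulerState {ρ₀ ρs₀ : ℝ} (hρ : 0 < ρ₀) (hcap : ρ₀ ≤ 2 * ρs₀) (σ θ₀ : ℝ)
    (u₀ A₀ A₄ : V3) (A : Fin 3 → V3) :
    (let ρ : ℝ := ρ₀
     let m : V3 := ρ₀ • u₀
     let e : ℝ := totalEnergyDensity ρ₀ u₀ θ₀
     let wb : V3 := ρ⁻¹ • m
     let p : ℝ := ρ * (2 / 3 * (e / ρ - ‖wb‖ ^ 2 / 2)) * hsCompressibility (min ρ (2 * ρs₀) * σ ^ 3)
     ⟪A₀, m⟫_ℝ + (∑ j, (⟪A j, m⟫_ℝ * wb j + p * A j j)) + ⟪A₄, wb⟫_ℝ * (e + p)) =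
      ∑ k, (A₀ k * (ρ₀ * u₀ k) +
        (∑ j, A j k * (ρ₀ * u₀ k * u₀ j + if k = j then hsPressure σ ρ₀ θ₀ else 0)) +
        A₄ k * ((totalEnergyDensity ρ₀ u₀ θ₀ + hsPressure σ ρ₀ θ₀) * u₀ k)) := by
  dsimp only
  have hρ0 : ρ₀ ≠ 0 := hρ.ne'
  have hwb : ρ₀⁻¹ • (ρ₀ • u₀) = u₀ := by rw [smul_smul, inv_mul_cancel₀ hρ0, one_smul]
  have hmin : min ρ₀ (2 * ρs₀) = ρ₀ := min_eq_left hcap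
  have hp : ρ₀ * (2 / 3 * (totalEnergyDensity ρ₀ u₀ θ₀ / ρ₀ - ‖u₀‖ ^ 2 / 2)) *
      hsCompressibility (ρ₀ * σ ^ 3) = hsPressure σ ρ₀ θ₀ := by
    unfold totalEnergyDensity hsPressure
    congr 1
    field_simp
    ring
  rw [hwb, hmin, hp]
  have hinner : ∀ a : V3, ⟪a, ρ₀ • u₀⟫_ℝ = ∑ k, a k * (ρ₀ * u₀ k) := fun a => by
    simp only [PiLp.inner_apply, RCLike.inner_apply, conj_trivial, PiLp.smul_apply, smul_eq_mul, mul_comm]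
  have hinner' : ⟪A₄, u₀⟫_ℝ = ∑ k, A₄ k * u₀ k := by
    simp only [PiLp.inner_apply, RCLike.inner_apply, conj_trivial, mul_comm]
  simp only [hinner, hinner', Fin.sum_univ_three, Fin.isValue, Fin.reduceEq, if_true, if_false]
  ring

end Defect


/-! ## The registered helper stub -/

/-- **Registered helper stub `stub_windowClauseEulerDefect` (plan § 1 D of stub 4a-ii, skeleton v8, crux stmt-17740)**:
sorry-free conjunction of `eulerFluxPairing_sub_linearised_self` and `visFluxIntegrand_eulerState`, restated with fully
qualified names (the registered one-line signature). -/
theorem stub_windowClauseEulerDefect : (∀ (θ : Literature.MathematicalPhysics.KineticTheory.T3 → ℝ) (u : Literature.MathematicalPhysics.KineticTheory.T3 → Literature.MathematicalPhysics.KineticTheory.V3), Literature.Analysis.FunctionSpaces.Torus.IsSmooth θ → Literature.Analysis.FunctionSpaces.Torus.IsSmooth u → (∀ x, 0 < θ x) → ∀ (σ ρ₀ : ℝ) (A₀ : Literature.MathematicalPhysics.KineticTheory.V3) (x : Literature.MathematicalPhysics.KineticTheory.T3), (let u₀ : Literature.MathematicalPhysics.KineticTheory.V3 := u x; let θ₀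 : ℝ := θ x; let Z : ℝ := Literature.MathematicalPhysics.KineticTheory.hsCompressibility (ρ₀ * σ ^ 3); let Z' : ℝ := deriv Literature.MathematicalPhysics.KineticTheory.hsCompressibility (ρ₀ * σ ^ 3); let p : ℝ := Literature.MathematicalPhysics.KineticTheory.hsPressure σ ρ₀ θ₀; let E : ℝ := Literature.MathematicalPhysics.KineticTheory.totalEnergyDensity ρ₀ u₀ θ₀; let A : Fin 3 → Literature.MathematicalPhysics.KineticTheory.V3 := fun j => Literature.Analysis.FunctionSpaces.Torus.gradient (fun y => u y j / θ y) x; let A₄ : Literature.MathematicalPhysics.KineticTheory.V3 := Literature.Analysis.FunctionSpaces.Torus.gradient (fun y => -(θ y)⁻¹) x; let F0 : Fin 3 → ℝ := fun k => ρ₀ * u₀ k; let Fm : Fin 3 → Fin 3 → ℝ := fun k j => ρ₀ * u₀ k * u₀ j + (if k = j then p else 0); let Fe : Fin 3 → ℝ := fun k => (E + p) * u₀ k; let δρ : ℝ := ρ₀; let δm : Literature.MathematicalPhysics.KineticTheory.V3 := ρ₀ • u₀; let δE : ℝ := E; let δu : Fin 3 → ℝ := fun k => (δm k - u₀ k * δρ)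 / ρ₀; let δp : ℝ := 2 / 3 * Z * (δE - (∑ j, u₀ j * δm j) + ‖u₀‖ ^ 2 / 2 * δρ) + θ₀ * (ρ₀ * σ ^ 3) * Z' * δρ; let δF0 : Fin 3 → ℝ := fun k => δm k; let δFm : Fin 3 → Fin 3 → ℝ := fun k j => u₀ j * δm k + u₀ k * δm j - u₀ k * u₀ j * δρ + (if k = j then δp else 0); let δFe : Fin 3 → ℝ := fun k => (E + p) * δu k + u₀ k * (δE + δp); (∑ k, (A₀ k * F0 k + (∑ j, A j k * Fm k j) + A₄ k * Fe k)) - ∑ k, (A₀ k * δF0 k + (∑ j, A j k * δFm k j) + A₄ k * δFe k) = -(ρ₀ * (ρ₀ * σ ^ 3) * Z' * Literature.Analysis.FunctionSpaces.Torus.divergence u x))) ∧ (∀ (ρ₀ ρs₀ : ℝ), 0 < ρ₀ → ρ₀ ≤ 2 * ρs₀ → ∀ (σ θ₀ : ℝ) (u₀ A₀ A₄ : Literature.MathematicalPhysics.KineticTheory.V3) (A : Fin 3 → Literature.MathematicalPhysics.KineticTheory.V3), (let ρ : ℝ := ρ₀; let m : Literature.MathematicalPhysics.KineticTheory.V3 :=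 ρ₀ • u₀; let e : ℝ := Literature.MathematicalPhysics.KineticTheory.totalEnergyDensity ρ₀ u₀ θ₀; let wb : Literature.MathematicalPhysics.KineticTheory.V3 := ρ⁻¹ • m; let p : ℝ := ρ * (2 / 3 * (e / ρ - ‖wb‖ ^ 2 / 2)) * Literature.MathematicalPhysics.KineticTheory.hsCompressibility (min ρ (2 * ρs₀) * σ ^ 3); inner ℝ A₀ m + (∑ j, (inner ℝ (A j) m * wb j + p * A j j)) + inner ℝ A₄ wb * (e + p) = ∑ k, (A₀ k * (ρ₀ * u₀ k) + (∑ j, A j k * (ρ₀ * u₀ k * u₀ j + if k = j then Literature.MathematicalPhysics.KineticTheory.hsPressure σ ρ₀ θ₀ else 0)) + A₄ k * ((Literature.MathematicalPhysics.KineticTheory.totalEnergyDensity ρ₀ u₀ θ₀ + Literature.MathematicalPhysics.KineticTheory.hsPressure σ ρ₀ θ₀) * u₀ k)))) :=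
  ⟨fun _ _ hθ hu hθ0 σ ρ₀ A₀ x => eulerFluxPairing_sub_linearised_self hθ hu hθ0 σ ρ₀ A₀ x,
    fun _ _ hρ hcap σ θ₀ u₀ A₀ A₄ A => visFluxIntegrand_eulerState hρ hcap σ θ₀ u₀ A₀ A₄ A⟩

end Summit.AtomisticToContinuum.HydrodynamicLimit.Theorems.LTEInBand

end
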